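import Summits.Parity.GeneralizedHardyLittlewood.Theorems.PrimeLevelFamEdgeMomentsBeyondDiagonalDiagRemTwoTwoEnvelopes
import HarnessLib

/-!
# Route `PrimeLevelFamEdge`, crux K_A `MomentsBeyondDiagonal` (stmt-Parity-20007), line «petersson_layers» v4, stub `stub_diag`:
# **the closing real inequality of the inner estimate of (R₃₃)** — the six envelopes of order `(3,3)` are `≤ KK·D²·Λ¹⁶·(s + 1/K)`

The order-`(3,3)` twin of `…DiagRemTwoTwoEnvelopes.envelope_arith₂₂` (p831499). The inner estimate of (R₃₃) (template
`…DiagRemOneThreeInner`, monomial bookkeeping `…DiagRemThreeThreeMonomials.abs_monomial_weight_le₃₃`) produces the six envelopes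

  `Ψ₀ = D(3C₀C₁ly²s + 18C₀C₂ly²x⁸/K)`, `Ψ₂ = 3C₀ly²ly⁴s + 18C₀C₂Dly⁴x⁸/K`, `Ψ₄ = 3C₀ly²(5ly⁶)s + 18C₀C₂D(5ly⁶)x⁸/K`,
  `Ψ₆ = 3C₀ly²(61ly⁸)s + 18C₀C₂D(61ly⁸)x⁸/K`,
  `Ψ_B = C₀((3(ly⁴+C_PD)ly⁴ + 3C_PD(ly⁴+C_PD) + (C_PD)²)s + (18ly⁴C_PD + 19(C_PD)²)x⁸/K)` (`…DiagRemBothSidedPow`),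
  `Ψ_BD = C₀((15(ly⁴+C_QD) + 5C_QD)ly⁶s + 95ly⁶C_QDx⁸/K)` (`…DiagRemBothSidedMixedPow`),

(`ly = 1+log Y ≤ Λ`, `x = 1+|log 2αY²| ≤ 2Λ`, `s = √(2αK₁Y)`, `K = (1+log K₁)^{14}`, `D = D(n) ≥ 1`) with the prefactors
`729Λ⁶ / 140Λ⁴ / 5Λ² / 1 / 15Λ² / 1`; every monomial `DᵃlyᵇxᶜΛᵈ` has `a ≤ 2`, `b + c + d ≤ 16`, so the total is
`≤ KKs·D²Λ¹⁶s + KKt·D²Λ¹⁶/K` — the budget of (R₃₃) (`Σ_cΣ_g D(cg)²/(cg²) ≪ log`, `Λ¹⁶·log/log¹⁴q̂ ≪ log³q̂`).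

* `pow_mono_aux` — `Dᵃ·lyᵇ·xᶜ·Λᵈ ≤ 2ᶜ·D²Λ¹⁶` for `a ≤ 2`, `b + c + d ≤ 16`;
* `envelope_arith₃₃` — **the closing inequality with explicit `KKs`, `KKt`.**

Def-free; theorems only; elementary. Helper `--supports stmt-Parity-20007`; closes nothing; K_A, K_B and the Parity summit are NOT
proved; nothing about Landau–Siegel zeros.

## References
* E. Kowalski, P. Michel, J. VanderKam, J. reine angew. Math. 526 (2000), (23)–(28) and Prop. 5.1 p. 18.
  [cite: KowalskiMichelVanderKam2000, (23)–(28) and Prop. 5.1 — derivation (order-(3,3) remainder, inner sums)]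
-/

noncomputable section

open Real

namespace Summit.Parity.GeneralizedHardyLittlewood.Theorems.MomentsBeyondDiagonal.DiagCorner

/-- `Dᵃ·lyᵇ·xᶜ·Λᵈ ≤ 2ᶜ·(D²·Λ¹⁶)` for `a ≤ 2`, `b + c + d ≤ 16` (`1 ≤ D`, `0 ≤ ly ≤ Λ`, `0 ≤ x ≤ 2Λ`, `1 ≤ Λ`). [folklore] -/
theorem pow_mono_aux {D ly x Lam : ℝ} (hD1 : 1 ≤ D) (hly0 : 0 ≤ ly) (hly : ly ≤ Lam) (hx0 : 0 ≤ x)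
    (hx : x ≤ 2 * Lam) (hLam : 1 ≤ Lam) (a b c d : ℕ) (ha : a ≤ 2) (h : b + c + d ≤ 16) :
    D ^ a * ly ^ b * x ^ c * Lam ^ d ≤ 2 ^ c * (D ^ 2 * Lam ^ 16) := by
  have hD0 : 0 ≤ D := by linarith
  have hLam0 : 0 ≤ Lam := by linarith
  have h1 : D ^ a ≤ D ^ 2 := pow_le_pow_right₀ hD1 ha
  have h2 : ly ^ b ≤ Lam ^ b := pow_le_pow_left₀ hly0 hly b
  have h3 : x ^ c ≤ (2 * Lam) ^ c := pow_le_pow_left₀ hx0 hx c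
  have h4 : Lam ^ (b + c + d) ≤ Lam ^ 16 := pow_le_pow_right₀ hLam h
  calc D ^ a * ly ^ b * x ^ c * Lam ^ d ≤ D ^ 2 * Lam ^ b * (2 * Lam) ^ c * Lam ^ d := by gcongr
    _ = 2 ^ c * (D ^ 2 * Lam ^ (b + c + d)) := by rw [mul_pow]; ring
    _ ≤ 2 ^ c * (D ^ 2 * Lam ^ 16) := by gcongr

/-- **The closing real inequality of the inner estimate of (R₃₃)** (module docstring). [folklore] -/
theorem envelope_arith₃₃ {D Lam ly x s K C₀ C₁ C₂ C_P C_Q : ℝ} (hD1 : 1 ≤ D) (hLam1 : 1 ≤ Lam) (hly0 : 0 ≤ ly)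
    (h1LY : ly ≤ Lam) (hx0 : 0 ≤ x) (hxLam : x ≤ 2 * Lam) (hs0 : 0 ≤ s) (hK : 0 < K) (hC₀ : 0 ≤ C₀)
    (hC₁ : 0 ≤ C₁) (hC₂ : 0 ≤ C₂) (hC_P : 0 ≤ C_P) (hC_Q : 0 ≤ C_Q) :
    729 * Lam ^ 6 * (D * (3 * C₀ * C₁ * ly ^ 2 * s + 18 * C₀ * C₂ * ly ^ 2 * x ^ 8 / K)) +
        140 * Lam ^ 4 * (3 * C₀ * ly ^ 2 * ly ^ 4 * s + 18 * C₀ * C₂ * D * ly ^ 4 * x ^ 8 / K) +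
        5 * Lam ^ 2 * (3 * C₀ * ly ^ 2 * (5 * ly ^ 6) * s + 18 * C₀ * C₂ * D * (5 * ly ^ 6) * x ^ 8 / K) +
        (3 * C₀ * ly ^ 2 * (61 * ly ^ 8) * s + 18 * C₀ * C₂ * D * (61 * ly ^ 8) * x ^ 8 / K) +
        15 * Lam ^ 2 * (C₀ * ((3 * (ly ^ 4 + C_P * D) * ly ^ 4 + 3 * (C_P * D) * (ly ^ 4 + C_P * D) + (C_P * D) ^ 2) * s +
          (18 * ly ^ 4 * (C_P * D) + 19 * (C_P * D) ^ 2) * x ^ 8 / K)) +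
        C₀ * ((15 * (ly ^ 4 + C_Q * D) + 5 * (C_Q * D)) * ly ^ 6 * s + 95 * ly ^ 6 * (C_Q * D) * x ^ 8 / K) ≤
      (C₀ * (2187 * C₁ + 420 + 75 + 183 + 45 + 90 * C_P + 60 * C_P ^ 2 + 15 + 20 * C_Q)) * (D ^ 2 * (Lam ^ 16 * s)) +
        (256 * (C₀ * (13122 * C₂ + 2520 * C₂ + 450 * C₂ + 1098 * C₂ + 270 * C_P + 285 * C_P ^ 2 + 95 * C_Q))) *
          (D ^ 2 * (Lam ^ 16 / K)) := by
  have hD0 : 0 ≤ D := zero_le_one.trans hD1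
  have hLam0 : 0 ≤ Lam := zero_le_one.trans hLam1
  have hM : 0 ≤ D ^ 2 * Lam ^ 16 := by positivity
  have hKi : 0 ≤ 1 / K := by positivity
  have P := fun (a b c d : ℕ) (ha : a ≤ 2) (h : b + c + d ≤ 16) ↦ pow_mono_aux hD1 hly0 h1LY hx0 hxLam hLam1 a b c d ha h
  -- the `s`-monomials (`c = 0`)
  have q1 : D ^ 1 * ly ^ 2 * x ^ 0 * Lam ^ 6 ≤ 2 ^ 0 * (D ^ 2 * Lam ^ 16) := P 1 2 0 6 (by norm_num) (by norm_num)
  have q2 : D ^ 0 * ly ^ 6 * x ^ 0 * Lam ^ 4 ≤ 2 ^ 0 * (D ^ 2 * Lam ^ 16) := P 0 6 0 4 (by norm_num) (by norm_num)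
  have q3 : D ^ 0 * ly ^ 8 * x ^ 0 * Lam ^ 2 ≤ 2 ^ 0 * (D ^ 2 * Lam ^ 16) := P 0 8 0 2 (by norm_num) (by norm_num)
  have q4 : D ^ 0 * ly ^ 10 * x ^ 0 * Lam ^ 0 ≤ 2 ^ 0 * (D ^ 2 * Lam ^ 16) := P 0 10 0 0 (by norm_num) (by norm_num)
  have q5 : D ^ 1 * ly ^ 4 * x ^ 0 * Lam ^ 2 ≤ 2 ^ 0 * (D ^ 2 * Lam ^ 16) := P 1 4 0 2 (by norm_num) (by norm_num)
  have q6 : D ^ 2 * ly ^ 0 * x ^ 0 * Lam ^ 2 ≤ 2 ^ 0 * (D ^ 2 * Lam ^ 16) := P 2 0 0 2 (by norm_num) (by norm_num)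
  have q7 : D ^ 1 * ly ^ 6 * x ^ 0 * Lam ^ 0 ≤ 2 ^ 0 * (D ^ 2 * Lam ^ 16) := P 1 6 0 0 (by norm_num) (by norm_num)
  -- the `1/K`-monomials (`c = 8`)
  have t1 : D ^ 1 * ly ^ 2 * x ^ 8 * Lam ^ 6 ≤ 2 ^ 8 * (D ^ 2 * Lam ^ 16) := P 1 2 8 6 (by norm_num) (by norm_num)
  have t2 : D ^ 1 * ly ^ 4 * x ^ 8 * Lam ^ 4 ≤ 2 ^ 8 * (D ^ 2 * Lam ^ 16) := P 1 4 8 4 (by norm_num) (by norm_num)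
  have t3 : D ^ 1 * ly ^ 6 * x ^ 8 * Lam ^ 2 ≤ 2 ^ 8 * (D ^ 2 * Lam ^ 16) := P 1 6 8 2 (by norm_num) (by norm_num)
  have t4 : D ^ 1 * ly ^ 8 * x ^ 8 * Lam ^ 0 ≤ 2 ^ 8 * (D ^ 2 * Lam ^ 16) := P 1 8 8 0 (by norm_num) (by norm_num)
  have t5 : D ^ 1 * ly ^ 4 * x ^ 8 * Lam ^ 2 ≤ 2 ^ 8 * (D ^ 2 * Lam ^ 16) := P 1 4 8 2 (by norm_num) (by norm_num)
  have t6 : D ^ 2 * ly ^ 0 * x ^ 8 * Lam ^ 2 ≤ 2 ^ 8 * (D ^ 2 * Lam ^ 16) := P 2 0 8 2 (by norm_num) (by norm_num)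
  have t7 : D ^ 1 * ly ^ 6 * x ^ 8 * Lam ^ 0 ≤ 2 ^ 8 * (D ^ 2 * Lam ^ 16) := P 1 6 8 0 (by norm_num) (by norm_num)
  -- multiply by the nonnegative coefficients (and by `s` resp. `1/K`)
  have r1 := mul_le_mul_of_nonneg_left (mul_le_mul_of_nonneg_right q1 hs0) (show 0 ≤ 2187 * C₀ * C₁ by positivity)
  have r2 := mul_le_mul_of_nonneg_left (mul_le_mul_of_nonneg_right q2 hs0) (show 0 ≤ 420 * C₀ by positivity)
  have r3 := mul_le_mul_of_nonneg_left (mul_le_mul_of_nonneg_right q3 hs0) (show 0 ≤ (75 + 45) * C₀ by positivity)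
  have r4 := mul_le_mul_of_nonneg_left (mul_le_mul_of_nonneg_right q4 hs0) (show 0 ≤ (183 + 15) * C₀ by positivity)
  have r5 := mul_le_mul_of_nonneg_left (mul_le_mul_of_nonneg_right q5 hs0) (show 0 ≤ 90 * C₀ * C_P by positivity)
  have r6 := mul_le_mul_of_nonneg_left (mul_le_mul_of_nonneg_right q6 hs0) (show 0 ≤ 60 * C₀ * C_P ^ 2 by positivity)
  have r7 := mul_le_mul_of_nonneg_left (mul_le_mul_of_nonneg_right q7 hs0) (show 0 ≤ 20 * C₀ * C_Q by positivity)
  have u1 := mul_le_mul_of_nonneg_left (mul_le_mul_of_nonneg_right t1 hKi) (show 0 ≤ 13122 * C₀ * C₂ by positivity)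
  have u2 := mul_le_mul_of_nonneg_left (mul_le_mul_of_nonneg_right t2 hKi) (show 0 ≤ 2520 * C₀ * C₂ by positivity)
  have u3 := mul_le_mul_of_nonneg_left (mul_le_mul_of_nonneg_right t3 hKi) (show 0 ≤ 450 * C₀ * C₂ by positivity)
  have u4 := mul_le_mul_of_nonneg_left (mul_le_mul_of_nonneg_right t4 hKi) (show 0 ≤ 1098 * C₀ * C₂ by positivity)
  have u5 := mul_le_mul_of_nonneg_left (mul_le_mul_of_nonneg_right t5 hKi) (show 0 ≤ 270 * C₀ * C_P by positivity)
  have u6 := mul_le_mul_of_nonneg_left (mul_le_mul_of_nonneg_right t6 hKi) (show 0 ≤ 285 * C₀ * C_P ^ 2 by positivity)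
  have u7 := mul_le_mul_of_nonneg_left (mul_le_mul_of_nonneg_right t7 hKi) (show 0 ≤ 95 * C₀ * C_Q by positivity)
  have hexp : 729 * Lam ^ 6 * (D * (3 * C₀ * C₁ * ly ^ 2 * s + 18 * C₀ * C₂ * ly ^ 2 * x ^ 8 / K)) +
        140 * Lam ^ 4 * (3 * C₀ * ly ^ 2 * ly ^ 4 * s + 18 * C₀ * C₂ * D * ly ^ 4 * x ^ 8 / K) +
        5 * Lam ^ 2 * (3 * C₀ * ly ^ 2 * (5 * ly ^ 6) * s + 18 * C₀ * C₂ * D * (5 * ly ^ 6) * x ^ 8 / K) +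
        (3 * C₀ * ly ^ 2 * (61 * ly ^ 8) * s + 18 * C₀ * C₂ * D * (61 * ly ^ 8) * x ^ 8 / K) +
        15 * Lam ^ 2 * (C₀ * ((3 * (ly ^ 4 + C_P * D) * ly ^ 4 + 3 * (C_P * D) * (ly ^ 4 + C_P * D) + (C_P * D) ^ 2) * s +
          (18 * ly ^ 4 * (C_P * D) + 19 * (C_P * D) ^ 2) * x ^ 8 / K)) +
        C₀ * ((15 * (ly ^ 4 + C_Q * D) + 5 * (C_Q * D)) * ly ^ 6 * s + 95 * ly ^ 6 * (C_Q * D) * x ^ 8 / K) =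
      2187 * C₀ * C₁ * (D ^ 1 * ly ^ 2 * x ^ 0 * Lam ^ 6 * s) + 420 * C₀ * (D ^ 0 * ly ^ 6 * x ^ 0 * Lam ^ 4 * s) +
        (75 + 45) * C₀ * (D ^ 0 * ly ^ 8 * x ^ 0 * Lam ^ 2 * s) + (183 + 15) * C₀ * (D ^ 0 * ly ^ 10 * x ^ 0 * Lam ^ 0 * s) +
        90 * C₀ * C_P * (D ^ 1 * ly ^ 4 * x ^ 0 * Lam ^ 2 * s) + 60 * C₀ * C_P ^ 2 * (D ^ 2 * ly ^ 0 * x ^ 0 * Lam ^ 2 * s) +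
        20 * C₀ * C_Q * (D ^ 1 * ly ^ 6 * x ^ 0 * Lam ^ 0 * s) +
        13122 * C₀ * C₂ * (D ^ 1 * ly ^ 2 * x ^ 8 * Lam ^ 6 * (1 / K)) +
        2520 * C₀ * C₂ * (D ^ 1 * ly ^ 4 * x ^ 8 * Lam ^ 4 * (1 / K)) +
        450 * C₀ * C₂ * (D ^ 1 * ly ^ 6 * x ^ 8 * Lam ^ 2 * (1 / K)) +
        1098 * C₀ * C₂ * (D ^ 1 * ly ^ 8 * x ^ 8 * Lam ^ 0 * (1 / K)) +
        270 * C₀ * C_P * (D ^ 1 * ly ^ 4 * x ^ 8 * Lam ^ 2 * (1 / K)) +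
        285 * C₀ * C_P ^ 2 * (D ^ 2 * ly ^ 0 * x ^ 8 * Lam ^ 2 * (1 / K)) +
        95 * C₀ * C_Q * (D ^ 1 * ly ^ 6 * x ^ 8 * Lam ^ 0 * (1 / K)) := by
    field_simp
    ring
  rw [hexp]
  have hrhs : (C₀ * (2187 * C₁ + 420 + 75 + 183 + 45 + 90 * C_P + 60 * C_P ^ 2 + 15 + 20 * C_Q)) * (D ^ 2 * (Lam ^ 16 * s)) +
        (256 * (C₀ * (13122 * C₂ + 2520 * C₂ + 450 * C₂ + 1098 * C₂ + 270 * C_P + 285 * C_P ^ 2 + 95 * C_Q))) *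
          (D ^ 2 * (Lam ^ 16 / K)) =
      2187 * C₀ * C₁ * (2 ^ 0 * (D ^ 2 * Lam ^ 16) * s) + 420 * C₀ * (2 ^ 0 * (D ^ 2 * Lam ^ 16) * s) +
        (75 + 45) * C₀ * (2 ^ 0 * (D ^ 2 * Lam ^ 16) * s) + (183 + 15) * C₀ * (2 ^ 0 * (D ^ 2 * Lam ^ 16) * s) +
        90 * C₀ * C_P * (2 ^ 0 * (D ^ 2 * Lam ^ 16) * s) + 60 * C₀ * C_P ^ 2 * (2 ^ 0 * (D ^ 2 * Lam ^ 16) * s) +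
        20 * C₀ * C_Q * (2 ^ 0 * (D ^ 2 * Lam ^ 16) * s) +
        13122 * C₀ * C₂ * (2 ^ 8 * (D ^ 2 * Lam ^ 16) * (1 / K)) +
        2520 * C₀ * C₂ * (2 ^ 8 * (D ^ 2 * Lam ^ 16) * (1 / K)) +
        450 * C₀ * C₂ * (2 ^ 8 * (D ^ 2 * Lam ^ 16) * (1 / K)) +
        1098 * C₀ * C₂ * (2 ^ 8 * (D ^ 2 * Lam ^ 16) * (1 / K)) +
        270 * C₀ * C_P * (2 ^ 8 * (D ^ 2 * Lam ^ 16) * (1 / K)) +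
        285 * C₀ * C_P ^ 2 * (2 ^ 8 * (D ^ 2 * Lam ^ 16) * (1 / K)) +
        95 * C₀ * C_Q * (2 ^ 8 * (D ^ 2 * Lam ^ 16) * (1 / K)) := by
    field_simp
    ring
  rw [hrhs]
  linarith only [r1, r2, r3, r4, r5, r6, r7, u1, u2, u3, u4, u5, u6, u7]

end Summit.Parity.GeneralizedHardyLittlewood.Theorems.MomentsBeyondDiagonal.DiagCorner

end
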